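import Mathlib

/-!
# Small Mahler measure census — typed statements and the rejection certificate (venture `DiscreteObjects`, target L)

Cell `pub-namedobj`, seat `pub-namedobj-mahler`. Framing: lottery ticket; floor = certified
bounds/negative ranges.

This file fixes, in Mathlib's vocabulary (`Polynomial.mahlerMeasure` over `ℂ`), the objects of the
census of integer polynomials of small Mahler measure:

* `intMahlerMeasure p` — the Mahler measure of `p : ℤ[X]` (via `ℤ → ℂ`);
* `lehmerPoly` — Lehmer's polynomial `x¹⁰+x⁹-x⁷-x⁶-x⁵-x⁴-x³+x+1` (`M = 1.17628081825991750654…`,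
  certified by the cell to 40 digits by two independent exact methods, see `CONTROLS-L.md`);
* `height p` — the naive height `max |aᵢ|`;
* `HeightBoundedCensus n h B L` — the STATEMENT "every integer polynomial of degree `n`, height `≤ h`
  and Mahler measure in `(1, B)` has the Mahler measure of some member of the explicit list `L`, and
  every member of `L` has degree `n`, height `≤ h` and measure in `(1, B)`" — the shape of each
  certified census row (`bound reached (height h, degree n)`); the lists themselves and the job
  certificates live in the cell's table, and an instance is asserted in Lean only as a `def … : Prop`.

and PROVES the soundness of the elementary rejection step used (in exact integer arithmetic) by the
census engines: if some coefficient violates Mahler's bound `‖aₖ‖ ≤ C(n,k)·B` then `B < M(p)`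
(`lt_mahlerMeasure_of_choose_mul_lt_norm_coeff`, from Mathlib's
`Polynomial.norm_coeff_le_choose_mul_mahlerMeasure`). The engines apply this to Graeffe iterates
`P_m` (roots `αᵢ^(2^m)`, `M(P_m) = M(P)^(2^m)`); that relation is named here as the predicate
`IsGraeffeIterate` (the identity `M(q) = M(p)^2` is not yet proved in Lean).
-/

namespace Summit.Ventures.DiscreteObjects.Mahler

open Polynomial

/-- The Mahler measure of an integer polynomial, through the embedding `ℤ → ℂ`. -/
noncomputable def intMahlerMeasure (p : ℤ[X]) : ℝ :=
  (p.map (Int.castRingHom ℂ)).mahlerMeasure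

/-- Lehmer's polynomial `x¹⁰ + x⁹ - x⁷ - x⁶ - x⁵ - x⁴ - x³ + x + 1` (Lehmer 1933). -/
noncomputable def lehmerPoly : ℤ[X] :=
  X ^ 10 + X ^ 9 - X ^ 7 - X ^ 6 - X ^ 5 - X ^ 4 - X ^ 3 + X + 1

/-- The naive height of an integer polynomial: the largest `|aᵢ|` (`0` for the zero polynomial). -/
def height (p : ℤ[X]) : ℕ :=
  p.support.sup fun i => (p.coeff i).natAbs

/-- The integer polynomial with ascending coefficient list `l` (`l[i]` is the coefficient of `X^i`). -/
noncomputable def ofCoeffs (l : List ℤ) : ℤ[X] :=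
  (l.zipIdx.map fun ai => C ai.1 * X ^ ai.2).sum

/-- Census row statement for (degree `n`, height `≤ h`, bound `B`) with witness list `L` (ascending
coefficient lists): the Mahler measures in `(1, B)` of integer polynomials of degree `n` and height
`≤ h` are exactly the Mahler measures of the listed polynomials, each of which is itself of degree `n`,
height `≤ h` and measure in `(1, B)`.  (`h = 0` is never used; "all heights" rows use
`DegreeCensus`.) -/
def HeightBoundedCensus (n h : ℕ) (B : ℝ) (L : List (List ℤ)) : Prop :=
  (∀ p : ℤ[X], p.natDegree = n → height p ≤ h → 1 < intMahlerMeasure p → intMahlerMeasure p < B →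
      ∃ l ∈ L, intMahlerMeasure p = intMahlerMeasure (ofCoeffs l)) ∧
  (∀ l ∈ L, (ofCoeffs l).natDegree = n ∧ height (ofCoeffs l) ≤ h ∧
      1 < intMahlerMeasure (ofCoeffs l) ∧ intMahlerMeasure (ofCoeffs l) < B)

/-- Census row statement for degree `n`, all heights: every IRREDUCIBLE integer polynomial of degree
`n` with Mahler measure in `(1, B)` is, up to sign and `x ↦ -x`, in the list `L`. -/
def DegreeCensus (n : ℕ) (B : ℝ) (L : List (List ℤ)) : Prop :=
  ∀ p : ℤ[X], p.natDegree = n → Irreducible p → 1 < intMahlerMeasure p → intMahlerMeasure p < B →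
    ∃ l ∈ L, p = ofCoeffs l ∨ p = -ofCoeffs l ∨ p = (ofCoeffs l).comp (-X) ∨ p = -(ofCoeffs l).comp (-X)

/-- **Rejection certificate, elementary step.** If the `k`-th coefficient of `p : ℂ[X]` exceeds
Mahler's bound `C(deg p, k) · B`, then `B < M(p)`.  The census engines reject a candidate exactly
when such an inequality holds (in integers, for a Graeffe iterate). -/
theorem lt_mahlerMeasure_of_choose_mul_lt_norm_coeff (p : ℂ[X]) (k : ℕ) {B : ℝ}
    (h : (p.natDegree.choose k : ℝ) * B < ‖p.coeff k‖) : B < p.mahlerMeasure := by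
  by_contra hle
  rw [not_lt] at hle
  have hc : (0 : ℝ) ≤ (p.natDegree.choose k : ℝ) := by positivity
  have := norm_coeff_le_choose_mul_mahlerMeasure k p
  have h2 : (p.natDegree.choose k : ℝ) * p.mahlerMeasure ≤ (p.natDegree.choose k : ℝ) * B :=
    mul_le_mul_of_nonneg_left hle hc
  linarith

/-- Integer form of the rejection step, as used by the engines: for `p : ℤ[X]` and a rational bound
`B`, `C(n,k) · B < |aₖ|` implies `B < M(p)`. -/
theorem lt_intMahlerMeasure_of_choose_mul_lt_abs_coeff (p : ℤ[X]) (k : ℕ) {B : ℚ}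
    (h : (p.natDegree.choose k : ℚ) * B < |(p.coeff k : ℚ)|) : (B : ℝ) < intMahlerMeasure p := by
  unfold intMahlerMeasure
  apply lt_mahlerMeasure_of_choose_mul_lt_norm_coeff _ k
  rw [natDegree_map_eq_of_injective (Int.castRingHom ℂ).injective_int, coeff_map]
  have h' : ((p.natDegree.choose k : ℚ) * B : ℝ) < (|(p.coeff k : ℚ)| : ℝ) := by exact_mod_cast h
  simpa [Rat.cast_mul, Rat.cast_natCast, Rat.cast_abs, Rat.cast_intCast] using h'

/-- The Graeffe transfer used by the engines, for a given pair: `q` is a Graeffe iterate of `p`, i.e.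
`q(x²) = ± p(x)·p(-x)` with `q` monic of the same degree; the engines use that then `M(q) = M(p)²`
(standard; the general implication is the certificate's second ingredient and is not yet proved in the
tree — this predicate only names the relation a certificate line asserts). -/
def IsGraeffeIterate (p q : ℤ[X]) : Prop :=
  q.Monic ∧ q.natDegree = p.natDegree ∧
    (q.comp (X ^ 2) = p * p.comp (-X) ∨ q.comp (X ^ 2) = -(p * p.comp (-X)))

end Summit.Ventures.DiscreteObjects.Mahler
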